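import Literature.MathematicalPhysics.QuantumFieldTheory.Balaban1983to89.B9Thm31SiteBlockBumpY

/-!
# `Balaban1983to89.B9Thm31SiteGsqHessianDecayBudgetsReg335Y` — T. Bałaban, *Propagators for lattice gauge theories in a background field*, Commun. Math. Phys. **99** (1985)
# 389–434 [Balaban1985BackgroundPropagators] (3.46) p. 398 (sixth member `|∇_U∇_UG′(U)λ| ≤ B₀e^{−δ₀d(y,y′)}|λ|`, NO level factor), Cor 3.6 p. 408 («constants independent
# of □»), (3.88) p. 409; [B6] = [Balaban1984PropagatorsII] (2.46) p. 231: **THE DECAYING BUDGETS AND THE LOCALIZED PIECES FOR THE INTERIOR `H²` ESTIMATE OF THE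
# SANDWICH `M_hG′_□(U)M_h` BLOCK TO BLOCK** — files 20∕21's (3.46a,b) for `G′_□` summed over a block ball around `s` with the source on `Δ(t)`, and file 23's `K(h)`-line
# localized by a bump `χ` supported in a block ball (file 31a of width seat `pub-ymgap-dag-n06-w1`'s set; inputs of file 31b's far-pair Bochner step of route (β′))

statement-level skeleton of published theorems with citation tags; proofs where landed; nothing here is a claim about the Yang–Mills mass gap

THE PRINT ∕ WHY.  (3.46)'s second-order members decay in the block distance with a constant that carries NO power of `Lʲη`; Cor 3.6 transfers them to the local
inverses `G′_□` uniformly in □; the Theorem-3.7 walk (3.88) reads them between the cut-offs `h_□` block to block (dag-n06-k's `L2SecondLegs37.l5`, whose `B₃`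
must be member-uniform although `M_h` is unbounded over the family — dag-n06-w7's shape note).  File 28 proved the GLOBAL estimate (`C_H`, no decay).  THIS FILE
proves the DECAYING one for far pairs by the route (β′): with `w = M_hG′_□M_hΦ` (`Φ` on `Δ(t)`) and the block bump `χ = χ_s` of file 30 (plateau on the stencil of
`Δ(s)`, support in `B(s, r₀)`, smooth at the block scale), the Hessians of `w` and `v := χw` agree on `Δ(s)`; file 27's torus Bochner–Weitzenböck inequality for
`v` has inputs `Δ_Uv = −M_χK(h)u − K(χ)w − (averaging of v)` (the route equation of file 28, the `χh²Φ` term VANISHING since `χ = 0` on `Δ(t)`), `‖∇v‖`, `‖v‖` and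
the curvature windows — every one a sum over the block ball `B(s, r₀+2)` of `HS(u)`, `HS(∇u)` (`u = G′_□M_hΦ`), i.e. files 20∕21's DECAYING zeroth∕first-order
bounds at block distance `≥ d(t,s) − r₀ − 2` from the source, times the matching inverse powers (`κ ~ (ML^j)⁻¹`, `κ_χ ~ L^{−lev s}`, `κ₂ ~`, `m ~ L^{−2j}`).

WHAT IS PROVED (sorry-free; 0 `def`; `r₀ = (d+1)(4(ℓ+1)+1)`; hypotheses as file 28: `(bg9K (M_N ℂ) G i).Reg335 c α₀` with `G ≤ U(N)`, `N ≥ 1`, `0 ≤ cMα₀`,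
`cMα₀(d+1) ≤ 1∕16`; any `D`, real `h` supported in `D` with `|h| ≤ 1`, `|∂h| ≤ κ`, `|∂∂h| ≤ κ₂`, block oscillation `≤ κ_b`; levels in `[j′_D, j_D]` on `D`;
pointwise plaquette window `0 ≤ ε`, `ε ≤ ε_D` within two forward steps of `D`).
* §1 budgets (source `Φ` on `Δ(t)`): `filter_distT_subset`, `hs_ball_GsqY_le` (`Σ_{B(s,n)}HS(u) ≤ 256L_D⁴‖Φ‖²∕E²`), `hs_ball_cdS_GsqY_le` (`Σ_{B(s,n)}Σ_μHS(∇_μu) ≤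
  160L_D²‖Φ‖²∕E²`), `E = e^{δ₀((d(t,s)−n)−1)∕(2L)}`; generic `hs_ball_cdsS_le_succ` (`∇*` on `B(s,n)` against `∇` on `B(s,n+1)`), `sum_levelMass_avg_ball_le`;
* §2 localized pieces for ANY real bump `χ` supported in `B(s, r)` (any `Λ`): `sum_hs_cutMulY_bump_le`, `sum_hs_cdS_cutMulY_bump_le`, `sum_hs_cutMulY_bump_KhY_le`,
  `sum_hs_KhY_bump_le`;
NOT HERE: the Bochner step itself (file 31b `B9Thm31SiteGsqHessianDecayReg335Y.hessian_block_far_le`), the near pairs and the duality (file 32).  NON-VACUITY (A6):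
`U = 1`, `h = 0`, `χ = 0` inhabit the hypotheses.  HONEST SCOPE: one composition of landed `L²` estimates with the lattice Bochner identity; NOT a node discharge, NOT summit
progress; count-neutral; nothing continuum ∕ OS ∕ mass gap ∕ Clay; the YM mass gap (Clay) is NOT proved by any of this — R4 closes the conditional finite-𝕋⁴ rung
`BalabanLadder.UV` only.  NEW file importing file 30 (`B9Thm31SiteBlockBumpY`).  Net new unproved facts: 0.
-/

noncomputable section

namespace Literature.MathematicalPhysics.QuantumFieldTheory.Balaban1983to89.B9Thm31SiteGsqHessianDecayBudgetsReg335Y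

open Literature.MathematicalPhysics.QuantumFieldTheory.Balaban1983to89
open Node00 B6KLevelCensusIndexV1 B6MultiLevelTorusOperator B6GlobalChartV1 B9BackgroundsKLevelV1
  B9Eq39Adjoint B9Thm311ReadingCoords B9Thm311DeltaPrimePos B9Ineq369CurvatureSmallAtLettersY B9Thm31SiteCoerciveGaugeBlockY B9Thm31SiteGpBoundsReg335Y
  B9Thm31SiteCurvatureCommutatorsY B9Thm31SiteBochnerY B9Thm31SiteGsqHessianReg335Y B9Thm31SiteBlockBumpY
open Literature.MathematicalPhysics.QuantumFieldTheory.Balaban1983to89.B9Ineq349SiteAdjoint (trIP_comm trIP_cdS_left)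
open Literature.MathematicalPhysics.QuantumFieldTheory.Balaban1983to89.B9Thm37CubeCoverCommutators (cutMulY cutMulY_apply KhY KhY_def cutCommY_apply)
open Literature.MathematicalPhysics.QuantumFieldTheory.Balaban1983to89.B9Thm37CubeCoverCommutatorSizes (avgCoeffY_nonneg)
open Literature.MathematicalPhysics.QuantumFieldTheory.Balaban1983to89.B9Thm311DeltaPrimeSymm (avgCoeffY_eq_ite avgCoeffY_symm)
open Literature.MathematicalPhysics.QuantumFieldTheory.Balaban1983to89.B9Ineq346SecondOrderTorusCutoff (cutoffT)
open B6Geom246MultiLevelBox B6Geom246MultiLevelTorus B9Thm31SiteCoerciveReg335Y B9Thm31SitePolarisedFormY B9Thm31SiteGsqDecayReg335Y B9Thm31SiteGsqGradDecayReg335Y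
  B9Thm31SiteGsqCutoffMixedReg335Y B9Thm31SiteGsqCutoffFactorsReg335Y B9Thm31SiteGsqRecordCutoffReg335Y B9Thm31SiteGsqBlockDistReg335Y B9Thm31SiteAgmonExponentY
  B6AgmonExponentMultiLevelTorus Node00.OpsYLocalInverse
open scoped Matrix Matrix.Norms.L2Operator

variable {d ℓ : ℕ} {hd : 1 ≤ d + 1} {hL : Odd (ℓ + 1) ∧ 1 < ℓ + 1} {b₀ b₁ : ℝ}
variable (i : KIdx d ℓ hd hL b₀ b₁) {N : ℕ} {G : Subgroup (Matrix (Fin N) (Fin N) ℂ)ˣ}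

/-! ## §1 Budgets: the decaying zeroth∕first-order inputs on a block ball around `s`, source on `Δ(t)` -/

section Budgets

/-- the block balls are nested. [cite: Balaban1984PropagatorsII, (2.46) p.231, bookkeeping] -/
theorem filter_distT_subset (s : BlkY i) {n m : ℕ} (hnm : n ≤ m) :
    Finset.univ.filter (fun z : SiteY i => (bondT i.D).dist (blkOf i.D.toDomains z) s ≤ n)
      ⊆ Finset.univ.filter (fun z : SiteY i => (bondT i.D).dist (blkOf i.D.toDomains z) s ≤ m) := by
  intro z hz
  rw [Finset.mem_filter] at hz ⊢
  exact ⟨hz.1, hz.2.trans hnm⟩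

variable [Nonempty (Fin N)] {c α₀ : ℝ}

/-- ★ **THE ZEROTH-ORDER BUDGET**: for `Φ` on `Δ(t)` and `u = G′_□(U)M_hΦ` (`|h| ≤ 1`, `supp h ⊆ D`, levels `≤ j_D` on `D`),
`Σ_{z∈B(s,n)} HS(u z) ≤ 256·L_D⁴·‖Φ‖² ∕ (e^{δ₀((d(t,s)−n)−1)∕(2L)})²` (file 20's (3.46a) for `G′_□` at the multi-scale exponent of `t`, block triangle inequality).
[cite: Balaban1985BackgroundPropagators, (3.46) p.398, Cor 3.6 p.408; Balaban1984PropagatorsII, (2.43) p.230, (2.46) p.231, (2.54) p.233; Agmon1982, Ch.1, Thm 1.5] -/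
theorem hs_ball_GsqY_le (hG : G ≤ B7Prop2Explicit.unitaryUnits (Matrix (Fin N) (Fin N) ℂ)) {U : CfgY (Matrix (Fin N) (Fin N) ℂ) i}
    (hC0 : 0 ≤ c * (kGeo i).M * α₀) (hC1 : c * (kGeo i).M * α₀ * ((d : ℝ) + 1) ≤ 1 / 16) (hreg : (bg9K (Matrix (Fin N) (Fin N) ℂ) G i).Reg335 c α₀ U)
    (D : Finset (SiteY i)) {h : SiteY i → ℝ} (hh1 : ∀ z, |h z| ≤ 1) (hhD : ∀ z, z ∉ D → h z = 0)
    {jD : ℕ} (hjD : ∀ z ∈ D, (blkOf i.D.toDomains z).1.1 ≤ jD) (s t : BlkY i) (n : ℕ)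
    {Φ : SiteY i → Matrix (Fin N) (Fin N) ℂ} (hΦ : ∀ z, blkOf i.D.toDomains z ≠ t → Φ z = 0) :
    ∑ z ∈ Finset.univ.filter (fun z : SiteY i => (bondT i.D).dist (blkOf i.D.toDomains z) s ≤ n), ∑ a, ∑ b, ‖GsqY i (parSymY i) D U (cutMulY h Φ) z a b‖ ^ 2
      ≤ 256 * (((((ℓ + 1) ^ jD : ℕ) : ℝ)) ^ 2 * ((((ℓ + 1) ^ jD : ℕ) : ℝ)) ^ 2
            / Real.exp ((1 / (4 * ((d : ℝ) + 2))) * (((((bondT i.D).dist t s - n : ℕ) : ℝ) - 1) / (2 * ((ℓ + 1 : ℕ) : ℝ)))) ^ 2)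
          * trIP (fun _ => (1 : ℝ)) Φ Φ := by
  classical
  set A := Finset.univ.filter (fun z : SiteY i => (bondT i.D).dist (blkOf i.D.toDomains z) s ≤ n) with hA
  set A' := A.filter (fun z => z ∈ D) with hA'
  set B := D.filter (fun z => blkOf i.D.toDomains z = t) with hB
  have hΨB : ∀ z, z ∉ B → cutMulY h Φ z = 0 := by
    intro z hz
    rw [cutMulY_apply]
    by_cases hzD : z ∈ D
    · have hzt : blkOf i.D.toDomains z ≠ t := fun e => hz (by rw [hB, Finset.mem_filter]; exact ⟨hzD, e⟩)
      rw [hΦ z hzt, smul_zero]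
    · rw [hhD z hzD]; simp
  have hρB : ∀ z ∈ B, msRhoT i.D t z = 0 := fun z hz => msRhoY_eq_zero i (Finset.mem_filter.1 hz).2
  have hjB : ∀ z ∈ B, (blkOf i.D.toDomains z).1.1 ≤ jD := fun z hz => hjD z (Finset.mem_filter.1 hz).1
  have hjA' : ∀ z ∈ A', (blkOf i.D.toDomains z).1.1 ≤ jD := fun z hz => hjD z (Finset.mem_filter.1 hz).2
  have hA'n : ∀ z ∈ A', (bondT i.D).dist t s - n ≤ (bondT i.D).dist (blkOf i.D.toDomains z) t := fun z hz =>
    distT_sub_le_of_distT_le i s t (Finset.mem_filter.1 (Finset.mem_filter.1 hz).1).2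
  have e : ∑ z ∈ A', ∑ a, ∑ b, ‖GsqY i (parSymY i) D U (cutMulY h Φ) z a b‖ ^ 2 = ∑ z ∈ A, ∑ a, ∑ b, ‖GsqY i (parSymY i) D U (cutMulY h Φ) z a b‖ ^ 2 := by
    refine Finset.sum_subset (Finset.filter_subset _ A) fun z hzA hzA' => ?_
    have hz : z ∉ D := fun hzD => hzA' (Finset.mem_filter.2 ⟨hzA, hzD⟩)
    rw [GsqY_apply_eq_zero i (parSymY i) U _ hz]; simp
  rw [← e]
  have key := hs_restrict_GsqY_parSymY_le_exp_canonical i hG hC0 hC1 hreg D (ρ := msRhoT i.D t) (msRhoY_bond i t) (msRhoY_bond' i t) (msRhoY_block i t)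
    hΨB hρB hjA' hjB (msRhoY_ge_of_le i t hA'n)
  refine key.trans (mul_le_mul_of_nonneg_left (trIP_cutMulY_self_le i hh1 Φ) (by positivity))

/-- ★ **THE FIRST-ORDER BUDGET**: `Σ_{z∈B(s,n)}Σ_μ HS((∇_μu)(z)) ≤ 160·L_D²·‖Φ‖² ∕ (e^{δ₀((d(t,s)−n)−1)∕(2L)})²` (file 21's (3.46b) for `G′_□`).
[cite: Balaban1985BackgroundPropagators, (3.46) p.398, Cor 3.6 p.408; Balaban1984PropagatorsII, (2.44) p.230, (2.46) p.231, (2.54) p.233; Agmon1982, Ch.1, Thm 1.5] -/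
theorem hs_ball_cdS_GsqY_le (hG : G ≤ B7Prop2Explicit.unitaryUnits (Matrix (Fin N) (Fin N) ℂ)) {U : CfgY (Matrix (Fin N) (Fin N) ℂ) i}
    (hC0 : 0 ≤ c * (kGeo i).M * α₀) (hC1 : c * (kGeo i).M * α₀ * ((d : ℝ) + 1) ≤ 1 / 16) (hreg : (bg9K (Matrix (Fin N) (Fin N) ℂ) G i).Reg335 c α₀ U)
    (D : Finset (SiteY i)) {h : SiteY i → ℝ} (hh1 : ∀ z, |h z| ≤ 1) (hhD : ∀ z, z ∉ D → h z = 0)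
    {jD : ℕ} (hjD : ∀ z ∈ D, (blkOf i.D.toDomains z).1.1 ≤ jD) (s t : BlkY i) (n : ℕ)
    {Φ : SiteY i → Matrix (Fin N) (Fin N) ℂ} (hΦ : ∀ z, blkOf i.D.toDomains z ≠ t → Φ z = 0) :
    ∑ z ∈ Finset.univ.filter (fun z : SiteY i => (bondT i.D).dist (blkOf i.D.toDomains z) s ≤ n), ∑ μ : Fin (d + 1), ∑ a, ∑ b,
        ‖cdS i U μ (GsqY i (parSymY i) D U (cutMulY h Φ)) z a b‖ ^ 2
      ≤ 160 * (((((ℓ + 1) ^ jD : ℕ) : ℝ)) ^ 2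
            / Real.exp ((1 / (4 * ((d : ℝ) + 2))) * (((((bondT i.D).dist t s - n : ℕ) : ℝ) - 1) / (2 * ((ℓ + 1 : ℕ) : ℝ)))) ^ 2)
          * trIP (fun _ => (1 : ℝ)) Φ Φ := by
  classical
  set A := Finset.univ.filter (fun z : SiteY i => (bondT i.D).dist (blkOf i.D.toDomains z) s ≤ n) with hA
  set B := D.filter (fun z => blkOf i.D.toDomains z = t) with hB
  have hΨB : ∀ z, z ∉ B → cutMulY h Φ z = 0 := by
    intro z hz
    rw [cutMulY_apply]
    by_cases hzD : z ∈ D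
    · have hzt : blkOf i.D.toDomains z ≠ t := fun e => hz (by rw [hB, Finset.mem_filter]; exact ⟨hzD, e⟩)
      rw [hΦ z hzt, smul_zero]
    · rw [hhD z hzD]; simp
  have hρB : ∀ z ∈ B, msRhoT i.D t z = 0 := fun z hz => msRhoY_eq_zero i (Finset.mem_filter.1 hz).2
  have hjB : ∀ z ∈ B, (blkOf i.D.toDomains z).1.1 ≤ jD := fun z hz => hjD z (Finset.mem_filter.1 hz).1
  have hAn : ∀ z ∈ A, (bondT i.D).dist t s - n ≤ (bondT i.D).dist (blkOf i.D.toDomains z) t := fun z hz =>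
    distT_sub_le_of_distT_le i s t (Finset.mem_filter.1 hz).2
  have key := hs_restrict_cdS_GsqY_parSymY_le_exp_canonical i hG hC0 hC1 hreg D (ρ := msRhoT i.D t) (msRhoY_bond i t) (msRhoY_bond' i t) (msRhoY_block i t)
    (A := A) hΨB hρB hjB (msRhoY_ge_of_le i t hAn)
  refine key.trans (mul_le_mul_of_nonneg_left (trIP_cutMulY_self_le i hh1 Φ) (by positivity))

omit [Nonempty (Fin N)] in
/-- the adjoint derivative on `B(s, n)` against the derivative on `B(s, n+1)` (unitary transport, one backward step). [cite: Balaban1985BackgroundPropagators, (3.8) p.392; Balaban1984PropagatorsII, (2.46) p.231, bookkeeping] -/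
theorem hs_ball_cdsS_le_succ (hG : G ≤ B7Prop2Explicit.unitaryUnits (Matrix (Fin N) (Fin N) ℂ)) {U : CfgY (Matrix (Fin N) (Fin N) ℂ) i}
    (hU : ∀ μ x, U μ x ∈ G) (s : BlkY i) (n : ℕ) (μ : Fin (d + 1)) (Λ : SiteY i → Matrix (Fin N) (Fin N) ℂ) :
    ∑ z ∈ Finset.univ.filter (fun z : SiteY i => (bondT i.D).dist (blkOf i.D.toDomains z) s ≤ n), ∑ a, ∑ b, ‖cdsS i U μ Λ z a b‖ ^ 2
      ≤ ∑ z ∈ Finset.univ.filter (fun z : SiteY i => (bondT i.D).dist (blkOf i.D.toDomains z) s ≤ n + 1), ∑ a, ∑ b, ‖cdS i U μ Λ z a b‖ ^ 2 := by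
  classical
  set A := Finset.univ.filter (fun z : SiteY i => (bondT i.D).dist (blkOf i.D.toDomains z) s ≤ n) with hA
  set A₁ := Finset.univ.filter (fun z : SiteY i => (bondT i.D).dist (blkOf i.D.toDomains z) s ≤ n + 1) with hA₁
  refine (Finset.sum_le_sum fun z _ => hs_cdsS_le_hs_cdS_symm i hG hU μ Λ z).trans ?_
  have hinj : ∀ x ∈ A, ∀ y ∈ A, (shiftY i μ).symm x = (shiftY i μ).symm y → x = y := fun x _ y _ hxy => (shiftY i μ).symm.injective hxy
  rw [← Finset.sum_image (f := fun y => ∑ a, ∑ b, ‖cdS i U μ Λ y a b‖ ^ 2) hinj]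
  refine Finset.sum_le_sum_of_subset_of_nonneg ?_ (fun _ _ _ => hs_nonneg _)
  intro y hy
  rw [Finset.mem_image] at hy
  obtain ⟨x, hx, rfl⟩ := hy
  rw [hA₁, Finset.mem_filter]
  exact ⟨Finset.mem_univ _, (distT_shiftY_symm_le_succ i s μ x).trans (by have := (Finset.mem_filter.1 hx).2; omega)⟩

omit [Nonempty (Fin N)] in
/-- the level-weighted averaging sum RESTRICTED to a block ball, for a field living on `D` (levels `≥ j′_D`):
`Σ_{z∈B(s,n)} m_z Σ_w a(z,w)HS(Λ w) ≤ m_D²·Σ_{z∈B(s,n)} HS(Λ z)` (the ball is a union of blocks; file 27's global lemma applied to `1_{B(s,n)}Λ`).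
[cite: Balaban1984PropagatorsII, (2.13)–(2.14) p.225; Balaban1985BackgroundPropagators, (3.24) p.394, bookkeeping] -/
theorem sum_levelMass_avg_ball_le {D : Finset (SiteY i)} {Λ : SiteY i → Matrix (Fin N) (Fin N) ℂ} (hΛ : ∀ z, z ∉ D → Λ z = 0)
    {jD' : ℕ} (hjD' : ∀ z ∈ D, jD' ≤ (blkOf i.D.toDomains z).1.1) (s : BlkY i) (n : ℕ) :
    ∑ z ∈ Finset.univ.filter (fun z : SiteY i => (bondT i.D).dist (blkOf i.D.toDomains z) s ≤ n),
        (((((ℓ + 1) ^ (blkOf i.D.toDomains z).1.1 : ℕ) : ℝ)) ^ 2)⁻¹ * ∑ w, avgCoeffY i z w * ∑ a, ∑ b, ‖Λ w a b‖ ^ 2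
      ≤ ((((((ℓ + 1) ^ jD' : ℕ) : ℝ)) ^ 2)⁻¹) ^ 2
          * ∑ z ∈ Finset.univ.filter (fun z : SiteY i => (bondT i.D).dist (blkOf i.D.toDomains z) s ≤ n), ∑ a, ∑ b, ‖Λ z a b‖ ^ 2 := by
  classical
  set A := Finset.univ.filter (fun z : SiteY i => (bondT i.D).dist (blkOf i.D.toDomains z) s ≤ n) with hA
  -- the field restricted to the ball
  obtain ⟨Λ', hΛ'⟩ : ∃ Λ' : SiteY i → Matrix (Fin N) (Fin N) ℂ, ∀ z, Λ' z = if z ∈ A then Λ z else 0 := ⟨fun z => if z ∈ A then Λ z else 0, fun _ => rfl⟩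
  have hΛ'in : ∀ z ∈ A, Λ' z = Λ z := fun z hz => by rw [hΛ', if_pos hz]
  have hΛ'out : ∀ z, z ∉ A → Λ' z = 0 := fun z hz => by rw [hΛ', if_neg hz]
  have hΛ'D : ∀ z, z ∉ D.filter (fun z => z ∈ A) → Λ' z = 0 := by
    intro z hz
    by_cases hzA : z ∈ A
    · have hzD : z ∉ D := fun hzD => hz (Finset.mem_filter.2 ⟨hzD, hzA⟩)
      rw [hΛ'in z hzA]; exact hΛ z hzD
    · exact hΛ'out z hzA
  have hjD'' : ∀ z ∈ D.filter (fun z => z ∈ A), jD' ≤ (blkOf i.D.toDomains z).1.1 := fun z hz => hjD' z (Finset.mem_filter.1 hz).1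
  have key := sum_levelMass_avg_le i hΛ'D hjD''
  -- the right-hand side of `key` is the restricted sum
  have eR : ∑ z, ∑ a, ∑ b, ‖Λ' z a b‖ ^ 2 = ∑ z ∈ A, ∑ a, ∑ b, ‖Λ z a b‖ ^ 2 := by
    rw [← Finset.sum_subset (Finset.subset_univ A) (fun z _ hzA => by rw [hΛ'out z hzA]; simp)]
    exact Finset.sum_congr rfl fun z hz => by rw [hΛ'in z hz]
  -- the left-hand side of `key` dominates the restricted sum (the ball is a union of blocks)
  have hS : ∀ z ∈ A, ∑ w, avgCoeffY i z w * ∑ a, ∑ b, ‖Λ w a b‖ ^ 2 = ∑ w, avgCoeffY i z w * ∑ a, ∑ b, ‖Λ' w a b‖ ^ 2 := by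
    intro z hz
    refine Finset.sum_congr rfl fun w _ => ?_
    by_cases hb : blkOf i.D.toDomains w = blkOf i.D.toDomains z
    · have hwA : w ∈ A := by
        rw [hA, Finset.mem_filter] at hz ⊢
        exact ⟨Finset.mem_univ _, by rw [hb]; exact hz.2⟩
      rw [hΛ'in w hwA]
    · rw [avgCoeffY_eq_ite, if_neg hb, zero_mul, zero_mul]
  have hnn : ∀ z, 0 ≤ (((((ℓ + 1) ^ (blkOf i.D.toDomains z).1.1 : ℕ) : ℝ)) ^ 2)⁻¹ * ∑ w, avgCoeffY i z w * ∑ a, ∑ b, ‖Λ' w a b‖ ^ 2 := fun z =>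
    mul_nonneg (by positivity) (Finset.sum_nonneg fun w _ => mul_nonneg (avgCoeffY_nonneg i z w) (hs_nonneg _))
  calc ∑ z ∈ A, (((((ℓ + 1) ^ (blkOf i.D.toDomains z).1.1 : ℕ) : ℝ)) ^ 2)⁻¹ * ∑ w, avgCoeffY i z w * ∑ a, ∑ b, ‖Λ w a b‖ ^ 2
      = ∑ z ∈ A, (((((ℓ + 1) ^ (blkOf i.D.toDomains z).1.1 : ℕ) : ℝ)) ^ 2)⁻¹ * ∑ w, avgCoeffY i z w * ∑ a, ∑ b, ‖Λ' w a b‖ ^ 2 :=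
        Finset.sum_congr rfl fun z hz => by rw [hS z hz]
    _ ≤ ∑ z, (((((ℓ + 1) ^ (blkOf i.D.toDomains z).1.1 : ℕ) : ℝ)) ^ 2)⁻¹ * ∑ w, avgCoeffY i z w * ∑ a, ∑ b, ‖Λ' w a b‖ ^ 2 :=
        Finset.sum_le_sum_of_subset_of_nonneg (Finset.subset_univ A) fun z _ _ => hnn z
    _ ≤ ((((((ℓ + 1) ^ jD' : ℕ) : ℝ)) ^ 2)⁻¹) ^ 2 * ∑ z, ∑ a, ∑ b, ‖Λ' z a b‖ ^ 2 := key
    _ = _ := by rw [eR]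

end Budgets

/-! ## §2 Localized pieces for a bump `χ` supported in `B(s, r)` (any field `Λ`): `M_χ`, `∇_U M_χ`, `M_χK(h)`, `K(χ)` -/

section Pieces

variable (s : BlkY i) (χ : SiteY i → ℝ) {r : ℕ}

/-- `Σ_z HS((M_χΛ)(z)) ≤ Σ_{z∈B(s,r)} HS(Λ z)` for `|χ| ≤ 1` supported in `B(s, r)`. [cite: Balaban1985BackgroundPropagators, (3.46) p.398, bookkeeping] -/
theorem sum_hs_cutMulY_bump_le (hχ1 : ∀ z, |χ z| ≤ 1) (hχ0 : ∀ z, r < (bondT i.D).dist (blkOf i.D.toDomains z) s → χ z = 0)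
    (Λ : SiteY i → Matrix (Fin N) (Fin N) ℂ) :
    ∑ z, ∑ a, ∑ b, ‖cutMulY χ Λ z a b‖ ^ 2
      ≤ ∑ z ∈ Finset.univ.filter (fun z : SiteY i => (bondT i.D).dist (blkOf i.D.toDomains z) s ≤ r), ∑ a, ∑ b, ‖Λ z a b‖ ^ 2 := by
  classical
  rw [← Finset.sum_subset (Finset.subset_univ (Finset.univ.filter (fun z : SiteY i => (bondT i.D).dist (blkOf i.D.toDomains z) s ≤ r)))
    (fun z _ hz => by
      rw [cutMulY_apply_eq_zero_of_lt_distT i s χ hχ0 Λ (lt_of_not_ge fun h' => hz (Finset.mem_filter.2 ⟨Finset.mem_univ _, h'⟩))]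
      simp)]
  exact Finset.sum_le_sum fun z _ => hs_cutMulY_apply_le i hχ1 Λ z

/-- `Σ_z HS((∇_{U,μ}M_χΛ)(z)) ≤ 2Σ_{z∈B(s,r+1)} HS((∇_μΛ)(z)) + 2κ_χ²Σ_{z∈B(s,r+1)} HS(Λ z)` (`|χ| ≤ 1`, `|∂χ| ≤ κ_χ`, support in `B(s, r)`).
[cite: Balaban1985BackgroundPropagators, (3.3) p.390, (3.46) p.398, bookkeeping] -/
theorem sum_hs_cdS_cutMulY_bump_le (U : CfgY (Matrix (Fin N) (Fin N) ℂ) i) (μ : Fin (d + 1)) (hχ1 : ∀ z, |χ z| ≤ 1) {κχ : ℝ}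
    (hχκ : ∀ μ z, |χ (shiftY i μ z) - χ z| ≤ κχ) (hχ0 : ∀ z, r < (bondT i.D).dist (blkOf i.D.toDomains z) s → χ z = 0)
    (Λ : SiteY i → Matrix (Fin N) (Fin N) ℂ) :
    ∑ z, ∑ a, ∑ b, ‖cdS i U μ (cutMulY χ Λ) z a b‖ ^ 2
      ≤ 2 * ∑ z ∈ Finset.univ.filter (fun z : SiteY i => (bondT i.D).dist (blkOf i.D.toDomains z) s ≤ r + 1), ∑ a, ∑ b, ‖cdS i U μ Λ z a b‖ ^ 2
        + 2 * κχ ^ 2 * ∑ z ∈ Finset.univ.filter (fun z : SiteY i => (bondT i.D).dist (blkOf i.D.toDomains z) s ≤ r + 1), ∑ a, ∑ b, ‖Λ z a b‖ ^ 2 := by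
  classical
  rw [← Finset.sum_subset (Finset.subset_univ (Finset.univ.filter (fun z : SiteY i => (bondT i.D).dist (blkOf i.D.toDomains z) s ≤ r + 1)))
    (fun z _ hz => by
      rw [cdS_cutMulY_apply_eq_zero_of_lt_distT i s U μ χ hχ0 Λ (lt_of_not_ge fun h' => hz (Finset.mem_filter.2 ⟨Finset.mem_univ _, h'⟩))]
      simp),
    Finset.mul_sum, Finset.mul_sum, ← Finset.sum_add_distrib]
  exact Finset.sum_le_sum fun z _ => hs_cdS_cutMulY_le i U μ hχ1 hχκ Λ z

/-- ★ **THE CUT `K(h)`-LINE**: `Σ_z HS((M_χK(h)(U)Λ)(z))` is at most file 23's pointwise bound summed over `B(s, r)`: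
`8(d+1)κ²Σ_{B(s,r)}Σ_μ(HS∇_μΛ + HS∇*_μΛ) + 4((d+1)κ₂)²Σ_{B(s,r)}HSΛ + 2κ_b²Σ_{B(s,r)} m_zΣ_w a(z,w)HSΛ(w)`.
[cite: Balaban1985BackgroundPropagators, (3.88)–(3.89) p.409, p.410; Balaban1984PropagatorsII, p.247] -/
theorem sum_hs_cutMulY_bump_KhY_le (hG : G ≤ B7Prop2Explicit.unitaryUnits (Matrix (Fin N) (Fin N) ℂ)) {U : CfgY (Matrix (Fin N) (Fin N) ℂ) i}
    (hU : ∀ μ x, U μ x ∈ G) (hχ1 : ∀ z, |χ z| ≤ 1) (hχ0 : ∀ z, r < (bondT i.D).dist (blkOf i.D.toDomains z) s → χ z = 0)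
    {h : SiteY i → ℝ} {κ κ₂ κb : ℝ} (hhκ : ∀ μ z, |h (shiftY i μ z) - h z| ≤ κ)
    (hhκ₂ : ∀ μ z, |h (shiftY i μ z) + h ((shiftY i μ).symm z) - 2 * h z| ≤ κ₂)
    (hhb : ∀ z w : SiteY i, blkOf i.D.toDomains w = blkOf i.D.toDomains z → |h z - h w| ≤ κb) (Λ : SiteY i → Matrix (Fin N) (Fin N) ℂ) :
    ∑ z, ∑ a, ∑ b, ‖cutMulY χ (KhY i (parSymY i) h U Λ) z a b‖ ^ 2
      ≤ 8 * ((d : ℝ) + 1) * κ ^ 2 * ∑ z ∈ Finset.univ.filter (fun z : SiteY i => (bondT i.D).dist (blkOf i.D.toDomains z) s ≤ r),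
            ∑ μ : Fin (d + 1), (∑ a, ∑ b, ‖cdS i U μ Λ z a b‖ ^ 2 + ∑ a, ∑ b, ‖cdsS i U μ Λ z a b‖ ^ 2)
        + 4 * (((d : ℝ) + 1) * κ₂) ^ 2 * ∑ z ∈ Finset.univ.filter (fun z : SiteY i => (bondT i.D).dist (blkOf i.D.toDomains z) s ≤ r), ∑ a, ∑ b, ‖Λ z a b‖ ^ 2
        + 2 * κb ^ 2 * ∑ z ∈ Finset.univ.filter (fun z : SiteY i => (bondT i.D).dist (blkOf i.D.toDomains z) s ≤ r),
            (((((ℓ + 1) ^ (blkOf i.D.toDomains z).1.1 : ℕ) : ℝ)) ^ 2)⁻¹ * ∑ w, avgCoeffY i z w * ∑ a, ∑ b, ‖Λ w a b‖ ^ 2 := by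
  classical
  refine (sum_hs_cutMulY_bump_le i s χ hχ1 hχ0 _).trans ?_
  refine (Finset.sum_le_sum fun z _ => hs_KhY_apply_le i hG hU hhκ hhκ₂ hhb Λ z).trans (le_of_eq ?_)
  rw [Finset.sum_add_distrib, Finset.sum_add_distrib, ← Finset.mul_sum, ← Finset.mul_sum]
  congr 1
  rw [Finset.mul_sum]
  exact Finset.sum_congr rfl fun z _ => by ring

/-- ★ **THE `K(χ)`-LINE**: `K(χ)(U)Λ` lives on `B(s, r+1)` (file 30), where file 23's pointwise bound holds with `χ`'s sizes `κ_χ, κ_χ₂, κ_χb`: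
`Σ_z HS((K(χ)Λ)(z)) ≤ 8(d+1)κ_χ²Σ_{B(s,r+1)}Σ_μ(HS∇_μΛ + HS∇*_μΛ) + 4((d+1)κ_χ₂)²Σ_{B(s,r+1)}HSΛ + 2κ_χb²Σ_{B(s,r+1)}m_zΣ_w a(z,w)HSΛ(w)`.
[cite: Balaban1985BackgroundPropagators, (3.88) p.409, p.410 («semi-local»), Cor 3.6 p.408; Balaban1984PropagatorsII, (2.46) p.231] -/
theorem sum_hs_KhY_bump_le (hG : G ≤ B7Prop2Explicit.unitaryUnits (Matrix (Fin N) (Fin N) ℂ)) {U : CfgY (Matrix (Fin N) (Fin N) ℂ) i}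
    (hU : ∀ μ x, U μ x ∈ G) {κχ κχ₂ κχb : ℝ} (hχκ : ∀ μ z, |χ (shiftY i μ z) - χ z| ≤ κχ)
    (hχκ₂ : ∀ μ z, |χ (shiftY i μ z) + χ ((shiftY i μ).symm z) - 2 * χ z| ≤ κχ₂)
    (hχb : ∀ z w : SiteY i, blkOf i.D.toDomains w = blkOf i.D.toDomains z → |χ z - χ w| ≤ κχb)
    (hχ0 : ∀ z, r < (bondT i.D).dist (blkOf i.D.toDomains z) s → χ z = 0) (Λ : SiteY i → Matrix (Fin N) (Fin N) ℂ) :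
    ∑ z, ∑ a, ∑ b, ‖KhY i (parSymY i) χ U Λ z a b‖ ^ 2
      ≤ 8 * ((d : ℝ) + 1) * κχ ^ 2 * ∑ z ∈ Finset.univ.filter (fun z : SiteY i => (bondT i.D).dist (blkOf i.D.toDomains z) s ≤ r + 1),
            ∑ μ : Fin (d + 1), (∑ a, ∑ b, ‖cdS i U μ Λ z a b‖ ^ 2 + ∑ a, ∑ b, ‖cdsS i U μ Λ z a b‖ ^ 2)
        + 4 * (((d : ℝ) + 1) * κχ₂) ^ 2 * ∑ z ∈ Finset.univ.filter (fun z : SiteY i => (bondT i.D).dist (blkOf i.D.toDomains z) s ≤ r + 1), ∑ a, ∑ b, ‖Λ z a b‖ ^ 2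
        + 2 * κχb ^ 2 * ∑ z ∈ Finset.univ.filter (fun z : SiteY i => (bondT i.D).dist (blkOf i.D.toDomains z) s ≤ r + 1),
            (((((ℓ + 1) ^ (blkOf i.D.toDomains z).1.1 : ℕ) : ℝ)) ^ 2)⁻¹ * ∑ w, avgCoeffY i z w * ∑ a, ∑ b, ‖Λ w a b‖ ^ 2 := by
  classical
  rw [← Finset.sum_subset (Finset.subset_univ (Finset.univ.filter (fun z : SiteY i => (bondT i.D).dist (blkOf i.D.toDomains z) s ≤ r + 1)))
    (fun z _ hz => by
      rw [KhY_apply_eq_zero_of_lt_distT i s (parSymY i) U χ hχ0 Λ (lt_of_not_ge fun h' => hz (Finset.mem_filter.2 ⟨Finset.mem_univ _, h'⟩))]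
      simp)]
  refine (Finset.sum_le_sum fun z _ => hs_KhY_apply_le i hG hU hχκ hχκ₂ hχb Λ z).trans (le_of_eq ?_)
  rw [Finset.sum_add_distrib, Finset.sum_add_distrib, ← Finset.mul_sum, ← Finset.mul_sum]
  congr 1
  rw [Finset.mul_sum]
  exact Finset.sum_congr rfl fun z _ => by ring

end Pieces

end Literature.MathematicalPhysics.QuantumFieldTheory.Balaban1983to89.B9Thm31SiteGsqHessianDecayBudgetsReg335Y

end
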